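import Summits.AtomisticToContinuum.FouriersLaw.Theorems.BondHeatUncertaintyExtensiveSnapshotIrreversibilityEnergyWindowHarrisResponseB

/-!
# «EnergyWindowHarrisResponse» (lens-1 g74 node K: S3 KernelTemperatureLipschitz, S3m, S1 EquilibriumSkeletonHarris PROVED at equilibrium, S3 ⟹ S3m telescoping, seam S1 → S3m → A1⁺ → A3i_TV) — part 3 of 3 (sequel of `…BondHeatUncertaintyExtensiveSnapshotIrreversibilityEnergyWindowHarrisResponseB`)

Split for the 400-line cap by the landing lane (hand-2 g30); the module docstring of part 1 (`…BondHeatUncertaintyExtensiveSnapshotIrreversibilityEnergyWindowHarrisResponseA`) describes the whole node.  Same namespace; all FQNs unchanged.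
0 sorry; standard axioms.
-/

noncomputable section

namespace Summit.AtomisticToContinuum.FouriersLaw.Theorems.ExtensiveSnapshotIrreversibility.EnergyWindow

open MeasureTheory ProbabilityTheory Filter Topology Real
open scoped ENNReal NNReal
open Literature.MathematicalPhysics.KineticTheory.HeatConduction
open Literature.Probability.Process

variable {N : ℕ}

/-! ## 5. The seam `S1 → S3m → A1⁺ → A3i_TV` -/

/-- ★ **THE SEAM `S1 → S3m → A1⁺ → A3i_TV`** (perturbation of a `V`-uniformly ergodic kernel,
Meyn–Tweedie Thm 16.0.1 style; here at rate pair `θ < θ' = (θ + 1/T)/2`).  For `0 < |δ| < δ₀`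
(small), let `Q = P_{T+δ/2,T−δ/2;m}` — the weak steady state `μ_δ` is `Q`-invariant (it is the
Krylov–Bogoliubov invariant probability measure of the perturbed semigroup, by weak-NESS
uniqueness) — and `ψ_k = P_{T,T;km} g − μ_T(g)`, `a_k = μ_δ(ψ_k)`.  Then `a_0 = μ_δ(g) − μ_T(g)`
(`P_0 = id`), `ψ_{k+1} = P_m ψ_k` (Chapman–Kolmogorov), `a_k = μ_δ(Qψ_k)` (invariance), so
`|a_k − a_{k+1}| = |μ_δ((Q − P_m)ψ_k)| ≤ C₃|δ| ᾱ^k B μ_δ(e^{θ'H}) ≤ C₃ C₁ B ᾱ^k |δ|` (S3m applied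
to `ψ_k/(ᾱ^k B)`, `|ψ_k| ≤ ᾱ^k B e^{θH}` by S1, A1⁺ at rate `θ'`), and `|a_n| ≤ ᾱⁿ B C₁ → 0`;
telescoping, `|μ_δ(g) − μ_T(g)| ≤ C₃ C₁ B |δ| /(1 − ᾱ)`. [cite: MeynTweedie1993, Thm 16.0.1]
[cite: HairerMajda2010, Thm 2.3] -/
theorem nessWeightedTVResponse_of_skeletonHarris_of_kernelLipschitz
    (h1 : EquilibriumSkeletonHarris) (h3 : KernelTemperatureLipschitzSkeleton)
    (hA : NessExpMomentBoundFull) : NessWeightedTVResponse := by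
  intro ω₂ lam β γ hω hl hβ hγ hU μ hμ T hT N hN θ hθ hθ1
  have hN0 : 0 < N := lt_of_lt_of_le (by norm_num) hN
  have hTθ : T < 1 / θ := (lt_one_div hθ hT).1 hθ1
  -- the auxiliary rate `θ' = (θ + 1/T)/2 ∈ (θ, 1/T)`
  set θ' : ℝ := (θ + 1 / T) / 2 with hθ'def
  have hθθ' : θ < θ' := by rw [hθ'def]; linarith
  have hθ'1 : θ' < 1 / T := by rw [hθ'def]; linarith
  have hθ' : 0 < θ' := hθ.trans hθθ'
  have hTθ' : T < 1 / θ' := (lt_one_div hθ' hT).1 hθ'1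
  have hθTT : θ < 1 / max T T := by rw [max_self]; exact hθ1
  set Hm := (pinnedChain ω₂ lam β γ).hamiltonian N with hHm
  have hHmeas : Measurable Hm := (pinnedChain_continuous_hamiltonian ω₂ lam β γ N).measurable
  have hH0 : ∀ z, 0 ≤ Hm z := fun z => pinnedChain_hamiltonian_nonneg hω.le hl.le hβ.le γ N z
  have hexpθθ' : ∀ z, Real.exp (θ * Hm z) ≤ Real.exp (θ' * Hm z) := fun z =>
    Real.exp_le_exp.2 (mul_le_mul_of_nonneg_right hθθ'.le (hH0 z))
  -- the three inputs
  obtain ⟨m, abar, B, hm, ha0, ha1, hB, hgeo⟩ := h1 ω₂ lam β γ hω hl hβ hγ hU T hT N hN θ hθ hθ1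
  obtain ⟨δ₃, C₃, hδ₃, hlip⟩ := h3 ω₂ lam β γ hω hl hβ hγ T hT N hN θ θ' hθ hθθ' hθ'1 m
  obtain ⟨δ₁, C₁, hδ₁, hmom⟩ := hA ω₂ lam β γ hω hl hβ hγ hU μ hμ T hT N hN θ' hθ' hθ'1
  set μT := (pinnedChain ω₂ lam β γ).gibbsMeasure N T with hμT
  haveI : IsProbabilityMeasure μT :=
    pinnedChain_isProbabilityMeasure_gibbsMeasure hω hl.le hβ.le γ N hT
  set C₃' : ℝ := max C₃ 0 with hC₃'
  have hC₃'0 : 0 ≤ C₃' := le_max_right _ _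
  refine ⟨min (min δ₁ δ₃) (min T (1 / θ' - T)), C₃' * C₁ * B / (1 - abar),
    lt_min (lt_min hδ₁ hδ₃) (lt_min hT (by linarith)), fun δ hδ0 hδ => ?_⟩
  have hδ1' : |δ| < δ₁ := (hδ.trans_le (min_le_left _ _)).trans_le (min_le_left _ _)
  have hδ3' : |δ| < δ₃ := (hδ.trans_le (min_le_left _ _)).trans_le (min_le_right _ _)
  have hδT : |δ| < T := (hδ.trans_le (min_le_right _ _)).trans_le (min_le_left _ _)
  have hδθ : |δ| < 1 / θ' - T := (hδ.trans_le (min_le_right _ _)).trans_le (min_le_right _ _)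
  obtain ⟨hδa, hδb⟩ := abs_lt.1 hδT
  obtain ⟨hδc, hδd⟩ := abs_lt.1 hδθ
  have hTL : 0 < T + δ / 2 := by linarith
  have hTR : 0 < T - δ / 2 := by linarith
  have hmax0 : 0 < max (T + δ / 2) (T - δ / 2) := lt_max_of_lt_left hTL
  have hθ'max : θ' < 1 / max (T + δ / 2) (T - δ / 2) :=
    (lt_one_div hθ' hmax0).2 (max_lt (by linarith) (by linarith))
  set μδ := μ N (T + δ / 2) (T - δ / 2) with hμδ
  haveI : IsProbabilityMeasure μδ := (hμ N _ _ hTL hTR).1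
  obtain ⟨hintδ, hC₁⟩ := hmom δ hδ0 hδ1'
  have hC₁0 : 0 ≤ C₁ := (integral_nonneg fun x => (Real.exp_pos _).le).trans hC₁
  -- the `e^{θ'H}`-moment of `μ_δ` as a Lebesgue integral
  have hμδV : ∫⁻ y, ENNReal.ofReal (Real.exp (θ' * Hm y)) ∂μδ ≤ ENNReal.ofReal C₁ := by
    rw [← ofReal_integral_eq_lintegral_ofReal hintδ (Eventually.of_forall fun x =>
      (Real.exp_pos _).le)]
    exact ENNReal.ofReal_le_ofReal hC₁
  -- toolbox at `μ_δ`: `|φ| ≤ L e^{θ'H}` ⟹ `φ ∈ L¹(μ_δ)`, `|μ_δ(φ)| ≤ L C₁`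
  have hTδ : ∀ (L : ℝ), 0 ≤ L → ∀ (φ : PhaseSpace N → ℝ), Measurable φ →
      (∀ y, |φ y| ≤ L * Real.exp (θ' * Hm y)) → Integrable φ μδ ∧ |∫ y, φ y ∂μδ| ≤ L * C₁ :=
    fun L hL φ hφm hφ =>
      integrable_and_abs_integral_le_of_abs_le_exp (pinnedChain ω₂ lam β γ) hHmeas hC₁0 hL hμδV
        hφm hφ
  refine ⟨(hTδ 1 zero_le_one _ ((hHmeas.const_mul θ).exp) (fun y => by
      rw [abs_of_pos (Real.exp_pos _), one_mul]; exact hexpθθ' y)).1, fun g hgm hg => ?_⟩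
  -- `μ_δ` is invariant under `Q = P^δ_m`
  obtain ⟨μKB, hμKB, hinv, hint⟩ := pinnedChainSemigroup_exists_isInvariant hω hl.le hβ hγ hN0 hTL hTR
    CuneoEckmannHairerReyBellet2018_H2_holds
  haveI := hμKB
  have hKBss : (pinnedChain ω₂ lam β γ).IsSteadyState N (T + δ / 2) (T - δ / 2) μKB :=
    pinnedChain_isSteadyState_of_isInvariant hω.le hl.le hβ.le γ N _ hinv hθ' (hint θ' hθ' hθ'max)
  have hμπ : μδ = μKB := hU N _ _ hTL hTR μδ μKB (hμ N _ _ hTL hTR) hKBss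
  have hQinv : μδ.bind ((pinnedChain ω₂ lam β γ).transitionKernel N (T + δ / 2) (T - δ / 2) m) =
      μδ := by
    have h : Kernel.Invariant
        ((pinnedChain ω₂ lam β γ).transitionKernel N (T + δ / 2) (T - δ / 2) m) μKB := hinv m
    rw [hμπ]; exact h
  -- `ψ_k = P_{km} g − μ_T(g)` and its properties
  set ψ : ℕ → PhaseSpace N → ℝ := fun k y =>
    ∫ w, g w ∂((pinnedChain ω₂ lam β γ).transitionKernel N T T ((k * m : ℕ) : ℝ≥0) y) -
      ∫ w, g w ∂μT with hψ
  have hψm : ∀ k, Measurable (ψ k) := fun k =>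
    (hgm.stronglyMeasurable.integral_kernel
      (κ := (pinnedChain ω₂ lam β γ).transitionKernel N T T ((k * m : ℕ) : ℝ≥0))).measurable.sub
      measurable_const
  have hLk : ∀ k, 0 ≤ abar ^ k * B := fun k => mul_nonneg (pow_nonneg ha0 k) hB
  have hψθ : ∀ k y, |ψ k y| ≤ abar ^ k * B * Real.exp (θ * Hm y) := fun k y => hgeo k g hgm hg y
  have hψθ' : ∀ k y, |ψ k y| ≤ abar ^ k * B * Real.exp (θ' * Hm y) := fun k y =>
    (hψθ k y).trans (mul_le_mul_of_nonneg_left (hexpθθ' y) (hLk k))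
  have hg1 : ∀ y, |g y| ≤ 1 * Real.exp (θ * Hm y) := fun y => by rw [one_mul]; exact hg y
  -- `ψ_{k+1} = P_m ψ_k`
  have hψsucc : ∀ k y, ψ (k + 1) y =
      ∫ w, ψ k w ∂((pinnedChain ω₂ lam β γ).transitionKernel N T T m y) := by
    intro k y
    haveI := pinnedChain_isMarkovKernel_transitionKernel hω hl.le hβ.le hγ.le N T T (m : ℝ≥0)
    have hcast : (((k + 1) * m : ℕ) : ℝ≥0) = (m : ℝ≥0) + ((k * m : ℕ) : ℝ≥0) := by
      push_cast; ring
    have hgi : Integrable g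
        ((pinnedChain ω₂ lam β γ).transitionKernel N T T ((m : ℝ≥0) + ((k * m : ℕ) : ℝ≥0)) y) :=
      (integrable_and_abs_integral_transitionKernel_le hω hl hβ hγ hN0 hT hT hθ hθTT _ y
        zero_le_one hgm hg1).1
    have hPgi : Integrable
        (fun w => ∫ u, g u ∂((pinnedChain ω₂ lam β γ).transitionKernel N T T ((k * m : ℕ) : ℝ≥0) w))
        ((pinnedChain ω₂ lam β γ).transitionKernel N T T m y) := by
      have := (integrable_and_abs_integral_transitionKernel_le hω hl hβ hγ hN0 hT hT hθ hθTT
        (m : ℝ≥0) y (hLk k) (hψm k) (hψθ k)).1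
      exact (this.add (integrable_const (∫ w, g w ∂μT))).congr
        (ae_of_all _ fun w => by simp only [hψ, Pi.add_apply, sub_add_cancel])
    show ∫ w, g w ∂((pinnedChain ω₂ lam β γ).transitionKernel N T T (((k + 1) * m : ℕ) : ℝ≥0) y) -
        ∫ w, g w ∂μT =
      ∫ w, (∫ u, g u ∂((pinnedChain ω₂ lam β γ).transitionKernel N T T ((k * m : ℕ) : ℝ≥0) w) -
        ∫ u, g u ∂μT) ∂((pinnedChain ω₂ lam β γ).transitionKernel N T T m y)
    rw [integral_sub hPgi (integrable_const _), integral_const, probReal_univ, one_smul, hcast,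
      integral_transitionKernel_add hω hl hβ hγ T T (m : ℝ≥0) _ y hgi]
  -- `a_k = μ_δ(ψ_k)`
  set a : ℕ → ℝ := fun k => ∫ y, ψ k y ∂μδ with ha
  -- `a_0 = μ_δ(g) − μ_T(g)`
  have ha0' : a 0 = ∫ y, g y ∂μδ - ∫ y, g y ∂μT := by
    have hgi : Integrable g μδ := (hTδ 1 zero_le_one g hgm (fun y => by
      rw [one_mul]; exact (hg y).trans (hexpθθ' y))).1
    show ∫ y, ψ 0 y ∂μδ = _
    have h0 : ∀ y, ψ 0 y = g y - ∫ w, g w ∂μT := fun y => by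
      show ∫ w, g w ∂((pinnedChain ω₂ lam β γ).transitionKernel N T T ((0 * m : ℕ) : ℝ≥0) y) -
          ∫ w, g w ∂μT = _
      rw [zero_mul, Nat.cast_zero, integral_transitionKernel_zero hω hl hβ hγ]
    simp_rw [h0]
    rw [integral_sub hgi (integrable_const _), integral_const, probReal_univ, one_smul]
  -- `|a_n| ≤ ᾱⁿ B C₁`
  have han : ∀ n, |a n| ≤ abar ^ n * B * C₁ := fun n => (hTδ _ (hLk n) _ (hψm n) (hψθ' n)).2
  -- `|a_k − a_{k+1}| ≤ C₃' C₁ B ᾱ^k |δ|`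
  have hstep : ∀ k, |a k - a (k + 1)| ≤ C₃' * |δ| * (abar ^ k * B) * C₁ := by
    intro k
    haveI := pinnedChain_isMarkovKernel_transitionKernel hω hl.le hβ.le hγ.le N T T (m : ℝ≥0)
    haveI := pinnedChain_isMarkovKernel_transitionKernel hω hl.le hβ.le hγ.le N (T + δ / 2)
      (T - δ / 2) (m : ℝ≥0)
    -- `Qψ_k`, `P_m ψ_k`: measurable, `O(e^{θ'H})`, hence `μ_δ`-integrable
    set Qψ : PhaseSpace N → ℝ := fun z =>
      ∫ y, ψ k y ∂((pinnedChain ω₂ lam β γ).transitionKernel N (T + δ / 2) (T - δ / 2) m z) with hQψ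
    set Pψ : PhaseSpace N → ℝ := fun z =>
      ∫ y, ψ k y ∂((pinnedChain ω₂ lam β γ).transitionKernel N T T m z) with hPψ
    have hQψm : Measurable Qψ := ((hψm k).stronglyMeasurable.integral_kernel
      (κ := (pinnedChain ω₂ lam β γ).transitionKernel N (T + δ / 2) (T - δ / 2) m)).measurable
    have hPψm : Measurable Pψ := ((hψm k).stronglyMeasurable.integral_kernel
      (κ := (pinnedChain ω₂ lam β γ).transitionKernel N T T m)).measurable
    have hsum : T + δ / 2 + (T - δ / 2) = 2 * T := by ring
    have hQψb : ∀ z, |Qψ z| ≤ abar ^ k * B * Real.exp (θ' * γ * (2 * T) * (m : ℝ≥0)) *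
        Real.exp (θ' * Hm z) := fun z => by
      have := (integrable_and_abs_integral_transitionKernel_le hω hl hβ hγ hN0 hTL hTR hθ' hθ'max
        (m : ℝ≥0) z (hLk k) (hψm k) (hψθ' k)).2
      rw [hsum] at this
      simpa only [mul_assoc] using this
    have hPψb : ∀ z, |Pψ z| ≤ abar ^ k * B * Real.exp (θ' * γ * (T + T) * (m : ℝ≥0)) *
        Real.exp (θ' * Hm z) := fun z => by
      have := (integrable_and_abs_integral_transitionKernel_le hω hl hβ hγ hN0 hT hT hθ'
        (by rw [max_self]; exact hθ'1) (m : ℝ≥0) z (hLk k) (hψm k) (hψθ' k)).2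
      simpa only [mul_assoc] using this
    have hQψi : Integrable Qψ μδ := (hTδ _ (by positivity) _ hQψm hQψb).1
    have hPψi : Integrable Pψ μδ := (hTδ _ (by positivity) _ hPψm hPψb).1
    -- `a_k = μ_δ(Qψ_k)` (invariance), `a_{k+1} = μ_δ(P_m ψ_k)` (Chapman–Kolmogorov)
    have hak : a k = ∫ z, Qψ z ∂μδ := by
      have hψi : Integrable (ψ k)
          (μδ.bind ((pinnedChain ω₂ lam β γ).transitionKernel N (T + δ / 2) (T - δ / 2) m)) := by
        rw [hQinv]; exact (hTδ _ (hLk k) _ (hψm k) (hψθ' k)).1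
      have h := Harris.integral_comp_measure
        ((pinnedChain ω₂ lam β γ).transitionKernel N (T + δ / 2) (T - δ / 2) m) μδ hψi
      rw [hQinv] at h
      exact h
    have hak1 : a (k + 1) = ∫ z, Pψ z ∂μδ := by
      show ∫ y, ψ (k + 1) y ∂μδ = _
      exact integral_congr_ae (ae_of_all _ (hψsucc k))
    -- the pointwise kernel bound (S3m, homogeneous form)
    have hpt : ∀ z, |Qψ z - Pψ z| ≤ C₃' * |δ| * (abar ^ k * B) * Real.exp (θ' * Hm z) := by
      intro z
      rcases (hLk k).eq_or_lt with hL0 | hLpos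
      · have hψ0 : ∀ y, ψ k y = 0 := fun y => by
          have := hψθ k y; rw [← hL0, zero_mul] at this; exact abs_nonpos_iff.1 this
        have hQ0 : Qψ z = 0 := by
          show ∫ y, ψ k y ∂_ = 0
          simp_rw [hψ0, integral_zero]
        have hP0 : Pψ z = 0 := by
          show ∫ y, ψ k y ∂_ = 0
          simp_rw [hψ0, integral_zero]
        rw [hQ0, hP0, sub_self, abs_zero, ← hL0]
        simp
      · have h := hlip δ hδ3' z (fun y => (abar ^ k * B)⁻¹ * ψ k y) ((hψm k).const_mul _)
          (fun y => by
            rw [abs_mul, abs_of_pos (inv_pos.2 hLpos), inv_mul_le_iff₀ hLpos]; exact hψθ k y)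
        rw [integral_const_mul, integral_const_mul, ← mul_sub, abs_mul,
          abs_of_pos (inv_pos.2 hLpos), inv_mul_le_iff₀ hLpos] at h
        refine h.trans ?_
        have hC : C₃ ≤ C₃' := le_max_left _ _
        calc abar ^ k * B * (C₃ * |δ| * Real.exp (θ' * Hm z))
            = C₃ * (abar ^ k * B * (|δ| * Real.exp (θ' * Hm z))) := by ring
          _ ≤ C₃' * (abar ^ k * B * (|δ| * Real.exp (θ' * Hm z))) :=
              mul_le_mul_of_nonneg_right hC (by positivity)
          _ = C₃' * |δ| * (abar ^ k * B) * Real.exp (θ' * Hm z) := by ring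
    rw [hak, hak1, ← integral_sub hQψi hPψi]
    exact (hTδ _ (by positivity) _ (hQψm.sub hPψm) hpt).2
  -- telescoping: `a_0 = Σ_{k<n} (a_k − a_{k+1}) + a_n`
  set K : ℝ := C₃' * |δ| * B * C₁ with hK
  have hK0 : 0 ≤ K := by positivity
  have hbound : ∀ n, |a 0| ≤ K * (1 - abar)⁻¹ + abar ^ n * (B * C₁) := by
    intro n
    have htel : a 0 = ∑ k ∈ Finset.range n, (a k - a (k + 1)) + a n := by
      rw [Finset.sum_range_sub']; ring
    rw [htel]
    refine (abs_add_le _ _).trans (add_le_add ?_ ?_)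
    · refine (Finset.abs_sum_le_sum_abs _ _).trans ?_
      calc ∑ k ∈ Finset.range n, |a k - a (k + 1)|
          ≤ ∑ k ∈ Finset.range n, K * abar ^ k :=
            Finset.sum_le_sum fun k _ => (hstep k).trans (le_of_eq (by rw [hK]; ring))
        _ = K * ∑ k ∈ Finset.range n, abar ^ k := by rw [Finset.mul_sum]
        _ ≤ K * (1 - abar)⁻¹ := by
            refine mul_le_mul_of_nonneg_left ?_ hK0
            have h := geom_sum_Ico_le_of_lt_one ha0 ha1 (m := 0) (n := n)
            rw [pow_zero, ← Finset.range_eq_Ico, one_div] at h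
            exact h
    · calc |a n| ≤ abar ^ n * B * C₁ := han n
        _ = abar ^ n * (B * C₁) := by ring
  -- `n → ∞`
  have hlim : Tendsto (fun n : ℕ => K * (1 - abar)⁻¹ + abar ^ n * (B * C₁)) atTop
      (𝓝 (K * (1 - abar)⁻¹ + 0 * (B * C₁))) :=
    tendsto_const_nhds.add ((tendsto_pow_atTop_nhds_zero_of_lt_one ha0 ha1).mul
      tendsto_const_nhds)
  rw [zero_mul, add_zero] at hlim
  have hfin : |a 0| ≤ K * (1 - abar)⁻¹ := ge_of_tendsto' hlim hbound
  rw [ha0'] at hfin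
  refine hfin.trans (le_of_eq ?_)
  rw [hK, div_eq_mul_inv]
  ring

/-! ## 6. Corollaries: `S3 ⟹ A3i_TV ⟹ A3i`, and the junction through the kernel leaf -/

/-- **S3 ⟹ A3i_TV** (S1 and A1⁺ are theorems). [folklore] -/
theorem nessWeightedTVResponse_of_kernelTemperatureLipschitz (h3 : KernelTemperatureLipschitz) :
    NessWeightedTVResponse :=
  nessWeightedTVResponse_of_skeletonHarris_of_kernelLipschitz equilibriumSkeletonHarris_holds
    (kernelTemperatureLipschitzSkeleton_of_kernelTemperatureLipschitz h3)
    nessExpMomentBoundFull_holds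

/-- **S3 ⟹ A3i** (`NessWeightedL1Response`). [folklore] -/
theorem nessWeightedL1Response_of_kernelTemperatureLipschitz (h3 : KernelTemperatureLipschitz) :
    NessWeightedL1Response :=
  nessWeightedL1Response_of_weightedTVResponse
    (nessWeightedTVResponse_of_kernelTemperatureLipschitz h3)

/-- **Glue `A0 → A2 → S3 → A3p → A4 → (W)`.** [folklore] -/
theorem energyWindowControl_of_atoms₅K (h0 : NessGibbsReweighting) (h2 : NessOddLogRatioBound)
    (h3 : KernelTemperatureLipschitz) (h3p : NessFloorMeanValue) (h4 : NessLinearResponseL2) :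
    EnergyWindowControl :=
  energyWindowControl_of_atoms₅ h0 h2 (nessWeightedL1Response_of_kernelTemperatureLipschitz h3)
    h3p h4

/-- ★ **The junction `K_fix ⟸ A0 ∧ A2 ∧ S3 ∧ A3p ∧ A4`.** [folklore] -/
theorem snapshotKLUpperExpansion_of_atoms₅K (h0 : NessGibbsReweighting)
    (h2 : NessOddLogRatioBound) (h3 : KernelTemperatureLipschitz) (h3p : NessFloorMeanValue)
    (h4 : NessLinearResponseL2) : SnapshotKLUpperExpansion :=
  snapshotKLUpperExpansion_of_atoms₅ h0 h2
    (nessWeightedL1Response_of_kernelTemperatureLipschitz h3) h3p h4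

end Summit.AtomisticToContinuum.FouriersLaw.Theorems.ExtensiveSnapshotIrreversibility.EnergyWindow

end
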